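import Summits.CriticalPhenomena.PercolationContinuityZ3.Theorems.PercNearOneGluingNoHeavyLowerTailCubicThreePointGluingJoinCells
import Summits.CriticalPhenomena.PercolationContinuityZ3.Theorems.PercNearOneGluingNoHeavyLowerTailCubicThreePointGluingPendantCells
import Summits.CriticalPhenomena.PercolationContinuityZ3.Theorems.PercNearOneGluingNoHeavyLowerTailCubicThreePointGluingMeasure
import Mathlib.Data.Finset.Sym
import HarnessLib

/-!
# `NoHeavyLowerTail` (stmt-CriticalPhenomena-4575) — decoupling across a vertex separator, part 6:
# Sahi's `E₃ ≥ 0` on the pairwise separations for EVERY weighted graph on ≤ 4 vertices, and on 5 vertices off the hub–hub edge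

Support file (prover prim-sahi-p2, SAHI cell P2; `--supports stmt-CriticalPhenomena-4575`).  No definitions, no named facts, no sorries.
Worked instances of the gluing moves of part 3 (`…GluingJoinCells`, `…GluingPendantCells`: `splaw_chord`, `splaw_join`, `splaw_pendant`, `splaw_swap12/13`) and the bridge of
part 5 (`…GluingMeasure`: `sahiE3_pairSep_nonneg_of_splaw`), with all structural side conditions discharged by `decide`:

* `splaw_blobTriangle`, `splaw_blobStar` — the two equality-locus skeletons of the censuses (ttrl2 sahi/README: Hb ≡ 0 on blob triangles,
  Ha ≡ 0 on blob stars) as infinite graph families with series–parallel law: three ARBITRARY two-terminal networks glued as a triangle at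
  `a, b, c`, resp. hung as arms at a hub; hence `AG ≥ 0`, the sharp dichotomy and SHK3⁺ = Sahi `E₃ ≥ 0` on them.
* `splaw_fin4` / **`sahiE3_pairSep_nonneg_fin4`** — on the vertex set `Fin 4` with terminals `0, 1, 2` (one Steiner vertex `3`), for EVERY weight
  function `w : Sym2 (Fin 4) → [0,1]` (the complete graph `K₄` with arbitrary edge probabilities, loops irrelevant): the three-point law is series–parallel
  (triangle of chords ⊔ star at `3`), hence `0 ≤ E₃({0≁1},{0≁2},{1≁2}) = sahiE3 (prodBernoulli w) (openConn 0 1)ᶜ (openConn 0 2)ᶜ (openConn 1 2)ᶜ`.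
  So the `|A| = 3` group-separation instance of Sahi's C₃ holds for all weighted graphs on at most four vertices.
* `splaw_fin5_noHubEdge` / **`sahiE3_pairSep_nonneg_fin5_of_hubEdge_zero`** — on `Fin 5` with terminals `0, 1, 2` and Steiner vertices `3, 4`, for every
  weight function with `w s(3,4) = 0` (triangle ⊔ star at `3` ⊔ star at `4`): the same conclusion.  The excluded hub–hub edge is exactly the first
  non-series-parallel skeleton `Θ = K_{2,3} + e` (prim-gen-kcluster KCLUSTER-gen9 §11, prim-ineq-gen-2 HMAX-SPLIT §5; memo PROOF-E3.md §2(C)): with it the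
  law is a hub-edge mixture of two series–parallel laws and the question is OPEN.
[cite: LiebSahi2021, eq. (2.1) and Conj. 1.1]; [cite: Gladkov2024StrongFKG, Cor. 4.2]
-/

noncomputable section

namespace Summit.CriticalPhenomena.PercolationContinuityZ3.Theorems

namespace TerminalGluing

open Finset SimpleGraph MeasureTheory Literature.Probability.Percolation Literature.Probability.Percolation.DecisionTree
open Literature.Probability.LatticeModels CubicThreePointStep CubicThreePointJoin


/-! ### Two infinite families: triangles of blobs and stars of blobs (the equality-locus skeletons of the census) -/

section Blobs

variable {V : Type*} [DecidableEq V] (p : Sym2 V → ℝ) (hp0 : ∀ i, 0 ≤ p i) (hp1 : ∀ i, p i ≤ 1) {a b c h : V}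
include hp0 hp1

/-- **Triangle of blobs.**  Three ARBITRARY two-terminal networks `Eab, Eac, Ebc` (edge sets avoiding the third terminal, pairwise disjoint, pairwise
meeting only in terminals), glued at `a, b, c`: the three-point law is series–parallel (`chord ⊔ chord ⊔ chord`), hence satisfies `AG ≥ 0`, the sharp
dichotomy, and SHK3⁺ = Sahi `E₃ ≥ 0` on the pairwise separations (`SPLaw.sharp`, `SPLaw.F_nonneg`, `sahiE3_pairSep_nonneg_of_splaw`). [folklore] -/
theorem splaw_blobTriangle {Eab Eac Ebc : Finset (Sym2 V)} (hab : ∀ e ∈ Eab, c ∉ e) (hac : ∀ e ∈ Eac, b ∉ e) (hbc : ∀ e ∈ Ebc, a ∉ e)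
    (hne₁ : a ≠ b) (hne₂ : a ≠ c) (hne₃ : b ≠ c) (hd₁ : Disjoint Eab Eac) (hd₂ : Disjoint (Eab ∪ Eac) Ebc)
    (hs₁ : ∀ v : V, ∀ e₁ ∈ Eab, ∀ e₂ ∈ Eac, v ∈ e₁ → v ∈ e₂ → (v = a ∨ v = b ∨ v = c))
    (hs₂ : ∀ v : V, ∀ e₁ ∈ Eab ∪ Eac, ∀ e₂ ∈ Ebc, v ∈ e₁ → v ∈ e₂ → (v = a ∨ v = b ∨ v = c)) :
    SPLaw (PrW (Eab ∪ Eac ∪ Ebc) p (evQ ∅ a b c)) (PrW (Eab ∪ Eac ∪ Ebc) p (evU₁ ∅ a b c))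
      (PrW (Eab ∪ Eac ∪ Ebc) p (evU₂ ∅ a b c)) (PrW (Eab ∪ Eac ∪ Ebc) p (evU₃ ∅ a b c))
      (PrW (Eab ∪ Eac ∪ Ebc) p (evT ∅ a b c)) := by
  have h₁ := splaw_chord Eab hp0 hp1 (K := ∅) (a := a) (b := b) (c := c)
    (fun e he => hab e (by simpa using he)) hne₂ hne₃
  have h₂ := splaw_swap13 _ (splaw_swap12 _ (splaw_swap13 _
    (splaw_chord Eac hp0 hp1 (K := ∅) (a := a) (b := c) (c := b) (fun e he => hac e (by simpa using he)) hne₁ hne₃.symm)))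
  have h₃ := splaw_swap13 _ (splaw_swap12 _
    (splaw_chord Ebc hp0 hp1 (K := ∅) (a := b) (b := c) (c := a) (fun e he => hbc e (by simpa using he)) hne₁.symm hne₂.symm))
  have hJ₁ := splaw_join p hd₁ (fun v e₁ he₁ e₂ he₂ => hs₁ v e₁ (by simpa using he₁) e₂ (by simpa using he₂)) h₁ h₂
  have hJ₂ := splaw_join p hd₂ (fun v e₁ he₁ e₂ he₂ => hs₂ v e₁ (by simpa using he₁) e₂ (by simpa using he₂)) hJ₁ h₃
  simpa only [Finset.union_empty] using hJ₂

/-- **Star of blobs.**  Three ARBITRARY two-terminal networks `Ea` (between `a` and a hub `h`), `Eb` (`h–b`), `Ec` (`h–c`) meeting only at the hub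
(and `Eb, Ec` possibly at the terminals `h, b, c`): the three-point law on `(a, b, c)` is series–parallel (the arm `Ea` hung at the cut vertex `h` of the
blob path `b–h–c`), hence satisfies `AG ≥ 0`, the sharp dichotomy and SHK3⁺ = Sahi `E₃ ≥ 0` on the pairwise separations. [folklore] -/
theorem splaw_blobStar {Ea Eb Ec : Finset (Sym2 V)} (ha : ∀ e ∈ Eb ∪ Ec, a ∉ e) (hb : ∀ e ∈ Ea, b ∉ e) (hc : ∀ e ∈ Ea, c ∉ e)
    (hbc : ∀ e ∈ Eb, c ∉ e) (hcb : ∀ e ∈ Ec, b ∉ e) (hne₁ : a ≠ b) (hne₂ : a ≠ c) (hne₃ : b ≠ c) (hnh₁ : h ≠ b) (hnh₂ : h ≠ c)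
    (hd₁ : Disjoint Eb Ec) (hd₂ : Disjoint Ea (Eb ∪ Ec))
    (hs₁ : ∀ v : V, ∀ e₁ ∈ Eb, ∀ e₂ ∈ Ec, v ∈ e₁ → v ∈ e₂ → (v = h ∨ v = b ∨ v = c))
    (hs₂ : ∀ v : V, ∀ e₁ ∈ Ea, ∀ e₂ ∈ Eb ∪ Ec, v ∈ e₁ → v ∈ e₂ → v = h) :
    SPLaw (PrW (Ea ∪ (Eb ∪ Ec)) p (evQ ∅ a b c)) (PrW (Ea ∪ (Eb ∪ Ec)) p (evU₁ ∅ a b c))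
      (PrW (Ea ∪ (Eb ∪ Ec)) p (evU₂ ∅ a b c)) (PrW (Ea ∪ (Eb ∪ Ec)) p (evU₃ ∅ a b c))
      (PrW (Ea ∪ (Eb ∪ Ec)) p (evT ∅ a b c)) := by
  -- the blob path b–h–c on the terminals (h, b, c)
  have hP₁ := splaw_chord Eb hp0 hp1 (K := ∅) (a := h) (b := b) (c := c)
    (fun e he => hbc e (by simpa using he)) hnh₂ hne₃
  have hP₂ := splaw_swap13 _ (splaw_swap12 _ (splaw_swap13 _
    (splaw_chord Ec hp0 hp1 (K := ∅) (a := h) (b := c) (c := b) (fun e he => hcb e (by simpa using he)) hnh₁ hne₃.symm)))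
  have hP := splaw_join p hd₁ (fun v e₁ he₁ e₂ he₂ => hs₁ v e₁ (by simpa using he₁) e₂ (by simpa using he₂)) hP₁ hP₂
  have hS := splaw_pendant p (D₁ := Ea) (K₁ := ∅) (a := a) hd₂ hp0 hp1
    (fun v e₁ he₁ e₂ he₂ => hs₂ v e₁ (by simpa using he₁) e₂ (by simpa using he₂))
    (fun e he => ha e (by simpa using he)) (fun e he => hb e (by simpa using he)) (fun e he => hc e (by simpa using he)) hne₁ hne₂ hP
  simpa only [Finset.union_empty] using hS

end Blobs

/-! ### Four vertices: `K₄` = triangle of chords ⊔ star -/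

section Fin4

variable (p : Sym2 (Fin 4) → ℝ) (hp0 : ∀ i, 0 ≤ p i) (hp1 : ∀ i, p i ≤ 1)
include hp0 hp1

/-- **Every weighted graph on four vertices has a series–parallel three-point law** (terminals `0,1,2`; all of `Sym2 (Fin 4)` as coordinates,
loops included and irrelevant).  Decomposition: chords `{01},{02},{12}` (with the loops at `0,2,1`) joined at the terminals, and the arm `{03}`
(with the loop at `3`) hung at the cut vertex `3` of the path `1–3–2`. [folklore] -/
theorem splaw_fin4 :
    SPLaw (PrW Finset.univ p (evQ ∅ (0 : Fin 4) 1 2)) (PrW Finset.univ p (evU₁ ∅ (0 : Fin 4) 1 2))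
      (PrW Finset.univ p (evU₂ ∅ (0 : Fin 4) 1 2)) (PrW Finset.univ p (evU₃ ∅ (0 : Fin 4) 1 2))
      (PrW Finset.univ p (evT ∅ (0 : Fin 4) 1 2)) := by
  -- the three chords (each with one loop), as laws on the terminals (0,1,2)
  have hT₁ := splaw_chord ({s(0, 1), s(0, 0)} : Finset (Sym2 (Fin 4))) hp0 hp1 (K := ∅) (a := 0) (b := 1) (c := 2)
    (by decide) (by decide) (by decide)
  have hT₂ := splaw_swap13 _ (splaw_swap12 _ (splaw_swap13 _
    (splaw_chord ({s(0, 2), s(2, 2)} : Finset (Sym2 (Fin 4))) hp0 hp1 (K := ∅) (a := 0) (b := 2) (c := 1)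
      (by decide) (by decide) (by decide))))
  have hT₃ := splaw_swap13 _ (splaw_swap12 _
    (splaw_chord ({s(1, 2), s(1, 1)} : Finset (Sym2 (Fin 4))) hp0 hp1 (K := ∅) (a := 1) (b := 2) (c := 0)
      (by decide) (by decide) (by decide)))
  have hJ₁ := splaw_join p (by decide) (by decide) hT₁ hT₂
  have hJ₂ := splaw_join p (by decide) (by decide) hJ₁ hT₃
  -- the star at 3: the path 1–3–2 (two chords on the terminals (3,1,2)) with the arm 0–3 hung at 3
  have hP₁ := splaw_chord ({s(1, 3)} : Finset (Sym2 (Fin 4))) hp0 hp1 (K := ∅) (a := 3) (b := 1) (c := 2)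
    (by decide) (by decide) (by decide)
  have hP₂ := splaw_swap13 _ (splaw_swap12 _ (splaw_swap13 _
    (splaw_chord ({s(2, 3)} : Finset (Sym2 (Fin 4))) hp0 hp1 (K := ∅) (a := 3) (b := 2) (c := 1)
      (by decide) (by decide) (by decide))))
  have hP := splaw_join p (by decide) (by decide) hP₁ hP₂
  have hS := splaw_pendant p (D₁ := ({s(0, 3), s(3, 3)} : Finset (Sym2 (Fin 4)))) (K₁ := ∅) (a := 0) (by decide) hp0 hp1
    (by decide) (by decide) (by decide) (by decide) (by decide) (by decide) hP
  have hAll := splaw_join p (by decide) (by decide) hJ₂ hS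
  have hD : (({s(0, 1), s(0, 0)} : Finset (Sym2 (Fin 4))) ∪ {s(0, 2), s(2, 2)} ∪ {s(1, 2), s(1, 1)} ∪
      ({s(0, 3), s(3, 3)} ∪ ({s(1, 3)} ∪ {s(2, 3)}))) = Finset.univ := by decide
  have hK : ((∅ : Finset (Sym2 (Fin 4))) ∪ ∅ ∪ ∅ ∪ (∅ ∪ (∅ ∪ ∅))) = ∅ := by simp
  rw [hD, hK] at hAll
  exact hAll

end Fin4

/-- **Sahi's C₃ instance on the pairwise separations holds for every weighted graph on four vertices**: for every `w : Sym2 (Fin 4) → [0,1]`,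
`0 ≤ E₃({0≁1},{0≁2},{1≁2})` under `prodBernoulli w`. [cite: LiebSahi2021, eq. (2.1) and Conj. 1.1 (here a theorem)] -/
theorem sahiE3_pairSep_nonneg_fin4 (w : Sym2 (Fin 4) → unitInterval) :
    0 ≤ sahiE3 (prodBernoulli w) (openConn (0 : Fin 4) 1)ᶜ (openConn (0 : Fin 4) 2)ᶜ (openConn (1 : Fin 4) 2)ᶜ :=
  sahiE3_pairSep_nonneg_of_splaw w 0 1 2 Finset.univ (fun e he => absurd (Finset.mem_univ e) he)
    (splaw_fin4 _ (fun e => unitInterval.nonneg (w e)) (fun e => unitInterval.le_one (w e)))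

/-! ### Five vertices without the hub–hub edge: triangle ⊔ star ⊔ star -/

section Fin5

variable (p : Sym2 (Fin 5) → ℝ) (hp0 : ∀ i, 0 ≤ p i) (hp1 : ∀ i, p i ≤ 1)
include hp0 hp1

/-- **Every weighted graph on five vertices avoiding the Steiner–Steiner edge `{3,4}` has a series–parallel three-point law** (terminals `0,1,2`;
coordinates = all of `Sym2 (Fin 5)` except `s(3,4)`): triangle of chords ⊔ star at `3` ⊔ star at `4`. [folklore] -/
theorem splaw_fin5_noHubEdge :
    SPLaw (PrW (Finset.univ.erase s(3, 4)) p (evQ ∅ (0 : Fin 5) 1 2)) (PrW (Finset.univ.erase s(3, 4)) p (evU₁ ∅ (0 : Fin 5) 1 2))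
      (PrW (Finset.univ.erase s(3, 4)) p (evU₂ ∅ (0 : Fin 5) 1 2)) (PrW (Finset.univ.erase s(3, 4)) p (evU₃ ∅ (0 : Fin 5) 1 2))
      (PrW (Finset.univ.erase s(3, 4)) p (evT ∅ (0 : Fin 5) 1 2)) := by
  have hT₁ := splaw_chord ({s(0, 1), s(0, 0)} : Finset (Sym2 (Fin 5))) hp0 hp1 (K := ∅) (a := 0) (b := 1) (c := 2)
    (by decide) (by decide) (by decide)
  have hT₂ := splaw_swap13 _ (splaw_swap12 _ (splaw_swap13 _
    (splaw_chord ({s(0, 2), s(2, 2)} : Finset (Sym2 (Fin 5))) hp0 hp1 (K := ∅) (a := 0) (b := 2) (c := 1)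
      (by decide) (by decide) (by decide))))
  have hT₃ := splaw_swap13 _ (splaw_swap12 _
    (splaw_chord ({s(1, 2), s(1, 1)} : Finset (Sym2 (Fin 5))) hp0 hp1 (K := ∅) (a := 1) (b := 2) (c := 0)
      (by decide) (by decide) (by decide)))
  have hJ₁ := splaw_join p (by decide) (by decide) hT₁ hT₂
  have hJ₂ := splaw_join p (by decide) (by decide) hJ₁ hT₃
  -- star at 3
  have hP₁ := splaw_chord ({s(1, 3)} : Finset (Sym2 (Fin 5))) hp0 hp1 (K := ∅) (a := 3) (b := 1) (c := 2)
    (by decide) (by decide) (by decide)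
  have hP₂ := splaw_swap13 _ (splaw_swap12 _ (splaw_swap13 _
    (splaw_chord ({s(2, 3)} : Finset (Sym2 (Fin 5))) hp0 hp1 (K := ∅) (a := 3) (b := 2) (c := 1)
      (by decide) (by decide) (by decide))))
  have hP := splaw_join p (by decide) (by decide) hP₁ hP₂
  have hS := splaw_pendant p (D₁ := ({s(0, 3), s(3, 3)} : Finset (Sym2 (Fin 5)))) (K₁ := ∅) (a := 0) (by decide) hp0 hp1
    (by decide) (by decide) (by decide) (by decide) (by decide) (by decide) hP
  -- star at 4
  have hQ₁ := splaw_chord ({s(1, 4)} : Finset (Sym2 (Fin 5))) hp0 hp1 (K := ∅) (a := 4) (b := 1) (c := 2)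
    (by decide) (by decide) (by decide)
  have hQ₂ := splaw_swap13 _ (splaw_swap12 _ (splaw_swap13 _
    (splaw_chord ({s(2, 4)} : Finset (Sym2 (Fin 5))) hp0 hp1 (K := ∅) (a := 4) (b := 2) (c := 1)
      (by decide) (by decide) (by decide))))
  have hQ := splaw_join p (by decide) (by decide) hQ₁ hQ₂
  have hS' := splaw_pendant p (D₁ := ({s(0, 4), s(4, 4)} : Finset (Sym2 (Fin 5)))) (K₁ := ∅) (a := 0) (by decide) hp0 hp1
    (by decide) (by decide) (by decide) (by decide) (by decide) (by decide) hQ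
  have hSS := splaw_join p (by decide) (by decide) hS hS'
  have hAll := splaw_join p (by decide) (by decide) hJ₂ hSS
  have hD : (({s(0, 1), s(0, 0)} : Finset (Sym2 (Fin 5))) ∪ {s(0, 2), s(2, 2)} ∪ {s(1, 2), s(1, 1)} ∪
      (({s(0, 3), s(3, 3)} ∪ ({s(1, 3)} ∪ {s(2, 3)})) ∪ ({s(0, 4), s(4, 4)} ∪ ({s(1, 4)} ∪ {s(2, 4)})))) =
        Finset.univ.erase s(3, 4) := by decide
  have hK : ((∅ : Finset (Sym2 (Fin 5))) ∪ ∅ ∪ ∅ ∪ ((∅ ∪ (∅ ∪ ∅)) ∪ (∅ ∪ (∅ ∪ ∅)))) = ∅ := by simp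
  rw [hD, hK] at hAll
  exact hAll

end Fin5

/-- **Sahi's C₃ instance on the pairwise separations for every weighted graph on five vertices without the Steiner–Steiner edge**:
`w s(3,4) = 0 ⇒ 0 ≤ E₃({0≁1},{0≁2},{1≁2})` under `prodBernoulli w` (terminals `0,1,2`).  With the edge `{3,4}` present the graph is the open
case `Θ = K_{2,3} + e`. [cite: LiebSahi2021, eq. (2.1) and Conj. 1.1 (here a theorem)] -/
theorem sahiE3_pairSep_nonneg_fin5_of_hubEdge_zero (w : Sym2 (Fin 5) → unitInterval) (h34 : w s(3, 4) = 0) :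
    0 ≤ sahiE3 (prodBernoulli w) (openConn (0 : Fin 5) 1)ᶜ (openConn (0 : Fin 5) 2)ᶜ (openConn (1 : Fin 5) 2)ᶜ := by
  refine sahiE3_pairSep_nonneg_of_splaw w 0 1 2 (Finset.univ.erase s(3, 4)) (fun e he => ?_)
    (splaw_fin5_noHubEdge _ (fun e => unitInterval.nonneg (w e)) (fun e => unitInterval.le_one (w e)))
  rw [Finset.mem_erase, not_and_or, not_not] at he
  rcases he with he | he
  · rw [he]; exact h34
  · exact absurd (Finset.mem_univ e) he

end TerminalGluing

end Summit.CriticalPhenomena.PercolationContinuityZ3.Theorems
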